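import Summits.ABC.IUTFork.Conditional.AbcOfSGenuineKChosenDepth
import Summits.ABC.IUTFork.Cor312GenuineKDeepDatumLam
import HarnessLib

/-!
# Branch C / R-W lane P− «HEX-SHARP», ENGINE-FREE EXPLICIT FLOOR: for every prime `l ≥ 11` and every
# `k` above ONE EXPLICIT INTEGER CRITERION, EVERY genuine Θ-volume datum over `λ_k = 1/2 + 2/7^k` is deep at
# the top label over `7`, so the hull-level clause S_H of the window certificates FAILS there (per datum)

PROOF-ONLY file (D-0012; 0 definitions, 0 `Prop` facts) of the abc-iut cell (seat abc-iut-w6-d102, gen 3; R-W sub-cell,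
WINDOW-SPEC §6 «HEX-SHARP», prover #2 «engine-free floor»; prover #1 abc-iut-w5-d163 holds the sharp ramification engine).
TAKES NO SIDE on [IUTchIII] Cor. 3.12 (S. Mochizuki, *Inter-universal Teichmüller theory III*, RIMS manuscript, Cor. 3.12
pp. 173–174, Step (xi-f) p. 184) or on any author.

WHAT IS ADDED (composition BY NAME; no new engine). abc-iut-c312-7's interface `GenuineK.exists_place_lamSeven`
(`Cor312GenuineKDeepDatumLam`) gives, at every datum `T : Cor22.ThetaVolumeDatumAt (ratPoint λ_k) l` (`k ≥ 1`, `l ≥ 11` prime), a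
fibre point `x₀ | 7` in the bad set with `‖t_q(x₀)‖ = 7^{−k/l}` EXACTLY (chosen realising q-idele) and the TAME-route ceiling
`d + a + b ≤ B(l) := 2 + log_7 N(l)`, `N(l) := 46080·l(l−1)²(l+1)`.  abc-iut-C-cert-1's `Hex.core_ineq` / abc-iut-c312-7's
`GenuineK.exists_deep_place_lamSeven_all` turn this into depth for `k ≥ k*` with an INEXPLICIT `k*` (an `∃` over an affine-log
bound).  Here the `∃` is replaced by the explicit integer criterion

  `(C)  7^{4l+4} · N(l)^{2l} ≤ 7^{k(l−3)}`,

which is the integer clearing of `4l + 2l·log_7 N(l) + 4l/(l+1) < k(l−3)` ⟺ `(j+1)·B(l) + 1 < (k/l)(j²−1)` at the top label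
`j = (l−1)/2` (floor-free; slack exactly `1/l` in the exponent).

* §1 `HexFloor.rpow_mul_pow_lt_one_of_criterion` — the arithmetic core: (C) ⟹ `7^{(j+1)B+1}·τ^{j²−1} < 1` for `0 ≤ τ ≤ 7^{−k/l}`.
* §2 `HexFloor.exists_deep_place_lamSeven_of_criterion` — (C) ⟹ at EVERY datum over `(λ_k, l)` the top-label packet over `7` is
  deep in abc-iut-w5-d107's explicit `(d,a,b)` form (verbatim the conclusion shape of `GenuineK.exists_deep_place_lamSeven_all`).
* §3 `HexFloor.not_pilotKummerCompatHull_lamSeven_of_criterion` — (C) ⟹ per datum, for EVERY choice of the free context binders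
  and Kummer data, the hull-level clause `Cor312Vol.PilotKummerCompatHull` at the sharp genuine K-setting with the CHOSEN realising
  ideles and the PINNED reading FAILS (abc-iut-C-cert-1 `GenuineK.not_pilotKummerCompatHull_chosen_of_explicit_depth`, p438886).
* §4 `HexFloor.criterion_mono` and the DECIDED TABLE `HexFloor.criterion_of_table`: `k♭(11) = 35`, `k♭(13) = 34`,
  `k♭(l) = 33` for `l ∈ {17, 19, 23, 29, 31, 37, 41, 43}` (kernel `norm_num` on the integer powers + monotonicity), packaged as
  `exists_deep_place_lamSeven_of_table` (the per-datum `¬ S_H` at a table row is `not_pilotKummerCompatHull_lamSeven_of_criterion`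
  fed with `criterion_of_table`); §5 `criterion_of_le_pow`: the uniform all-primes fallback `l ≤ 7^m ∧ (16+8m)·l + 4 ≤ k(l−3) ⟹ (C)`.

RELATION TO THE FLOOR OF RECORD (abc-iut-rp-m4, `AbcOfSGenuineKChosenDepthHexSharp`, p454167): that file decides the same family
with the integer-`m` test `N(l) < 7^m ∧ l·((j+1)(2+m)+1) < k(j²−1)` (thresholds 37 at `l = 11`, 35 at `l = 13`); the criterion (C)
here does not round `log_7 N(l)` up to an integer and reaches the exact thresholds of the real inequality at the tame-route
ceiling `B(l)` (35, 34, 33, …) — the boundary classes `HEX:35–36:11`, `HEX:34:13`, `HEX:33–34:17`, `HEX:33:19`, `HEX:33:29`,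
`HEX:33:31` are decided here and not there; nothing of p454167 is restated (different hypotheses, namespace `HexFloor`).
R-W reading (WINDOW-SPEC §3b/§6): every WINDOW-TABLE row `HEX:k:l@p7.j((l−1)/2)` with `k ≥ k♭(l)` is REFUTED-dab BY THEOREM
(deciding decl §3/§4); below `k♭(l)` no tame-route file can go — the sharp ramification engine of prover #1 is needed.

HONEST SCOPE: SHARP reading; the per-label licence is a STRONGER-THAN-PRINT sufficient form of (xi-f) (ADJUDICATION-SPEC (G1′));
failure at the deep top-label packet says NOTHING about the printed GLOBAL inequality `−|log(q)| ≤ −|log(Θ)|` (compensation across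
packets), the number-level `Cor22.Cor312AtDatum` (abc-iut-c312-d1: every HEX row is Szpiro-GOOD, so these rows consume no hypothesis
of the cut certificate `abc_of_SH_v10K_window_szpiroBadBoth` — a faithfulness test of OUR typing, off the conditional's critical path),
or any author's intended hull; no side taken on any author; typed ≠ proved; refuted-as-typed ≠ refuted-in-print; no abc claim.
[cite: Mochizuki2012, IUTchIII Cor. 3.12 Step (xi-f) p. 184; IUTchIV Prop. 1.2 p. 10, Cor. 2.2 (ii) proof (P5) p. 46]
[cite: ScholzeStix2018, §2.2 pp. 9–10] [cite: DupuyHilado2025, §3.4] [claim: Mochizuki2012, status: disputed] for every IUT quotation.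
-/

noncomputable section

open Set Function NumberField IsDedekindDomain

namespace Summit.ABC.IUTFork.Conditional

open Thm311 Thm311.Real Cor312 Cor312Vol Cor312Prov Literature.IUT.LogThetaLattice Literature.IUT.LogVolume
  Literature.IUT.HodgeTheaters Literature.IUT.LogVolume.ThetaData
  Literature.NumberTheory.DiophantineGeometry.GenEll Summit.ABC.ABC.Theorems

namespace HexFloor

/-! ## §1. The explicit arithmetic core (floor-free) -/

/-- **Arithmetic core, explicit form.** For odd `l ≥ 11` with top label `j = (l−1)/2`, `1 ≤ N`, a ceiling `B ≤ 2 + log N / log 7`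
and `0 ≤ τ ≤ 7^{−k/l}`: the integer criterion `7^{4l+4}·N^{2l} ≤ 7^{k(l−3)}` gives `7^{(j+1)·B + 1} · τ^{j²−1} < 1`
(exponent `(j+1)B + 1 − (k/l)(j²−1) ≤ −1/l < 0`).  Written with `j+1 = ((l−1)/2 − 1 : ℕ) + 2` as the consumers state it. [folklore] -/
theorem rpow_mul_pow_lt_one_of_criterion (k l N : ℕ) (B τ : ℝ) (h11 : 11 ≤ l) (hodd : l % 2 = 1) (hN1 : 1 ≤ N)
    (hB : B ≤ 2 + Real.log N / Real.log 7)
    (hcrit : 7 ^ (4 * l + 4) * N ^ (2 * l) ≤ 7 ^ (k * (l - 3)))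
    (hτ0 : 0 ≤ τ) (hτ : τ ≤ (7 : ℝ) ^ (-((k : ℝ) / l))) :
    (7 : ℝ) ^ (((((l - 1) / 2 - 1 : ℕ) : ℝ) + 2) * B + 1) * τ ^ (((l - 1) / 2) ^ 2 - 1) < 1 := by
  have h7 : (1 : ℝ) < 7 := by norm_num
  have h70 : (0 : ℝ) < 7 := by norm_num
  have hlog7 : 0 < Real.log 7 := Real.log_pos h7
  have hlpos : (0 : ℝ) < l := by exact_mod_cast (show 0 < l by omega)
  -- the label `j = (l-1)/2`, `2j = l - 1`, `j ≥ 5`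
  set j : ℕ := (l - 1) / 2 with hj
  have h2j : 2 * j = l - 1 := by omega
  have hj5 : 5 ≤ j := by omega
  have hjR : (j : ℝ) = ((l : ℝ) - 1) / 2 := by
    have : ((2 * j : ℕ) : ℝ) = ((l - 1 : ℕ) : ℝ) := by exact_mod_cast h2j
    push_cast [Nat.cast_sub (show 1 ≤ l by omega)] at this
    linarith
  have hcast1 : ((((l - 1) / 2 - 1 : ℕ) : ℝ) + 2) = (j : ℝ) + 1 := by
    rw [← hj, Nat.cast_sub (show 1 ≤ j by omega)]
    push_cast; ring
  have hcast2 : (((l - 1) / 2) ^ 2 - 1 : ℕ) = (j - 1) * (j + 1) := by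
    rw [← hj]
    have : 1 ≤ j ^ 2 := Nat.one_le_pow _ _ (by omega)
    zify [this, show 1 ≤ j by omega]
    ring
  rw [hcast1, hcast2]
  -- the criterion, in logarithms: `(4l+4)·log 7 + 2l·log N ≤ k(l-3)·log 7`
  have hNR : (1 : ℝ) ≤ N := by exact_mod_cast hN1
  have hcritR : (7 : ℝ) ^ (4 * l + 4) * (N : ℝ) ^ (2 * l) ≤ (7 : ℝ) ^ (k * (l - 3)) := by exact_mod_cast hcrit
  have hlogcrit : ((4 * l + 4 : ℕ) : ℝ) * Real.log 7 + ((2 * l : ℕ) : ℝ) * Real.log N ≤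
      ((k * (l - 3) : ℕ) : ℝ) * Real.log 7 := by
    have h := Real.log_le_log (by positivity) hcritR
    rwa [Real.log_mul (by positivity) (by positivity), Real.log_pow, Real.log_pow, Real.log_pow] at h
  have hl3 : ((k * (l - 3) : ℕ) : ℝ) = (k : ℝ) * ((l : ℝ) - 3) := by
    push_cast [Nat.cast_sub (show 3 ≤ l by omega)]; ring
  rw [hl3] at hlogcrit
  push_cast at hlogcrit
  -- `log N / log 7 ≤ (k(l-3) - 4l - 4)/(2l)`
  have hlogN : Real.log N / Real.log 7 ≤ ((k : ℝ) * ((l : ℝ) - 3) - 4 * l - 4) / (2 * l) := by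
    rw [div_le_div_iff₀ hlog7 (by positivity)]
    nlinarith
  have hB' : B ≤ ((k : ℝ) * ((l : ℝ) - 3) - 4) / (2 * l) := by
    have : 2 + ((k : ℝ) * ((l : ℝ) - 3) - 4 * l - 4) / (2 * l) = ((k : ℝ) * ((l : ℝ) - 3) - 4) / (2 * l) := by
      field_simp; ring
    linarith [hB, hlogN, this]
  -- the key exponent inequality
  have hj1 : (0 : ℝ) < (j : ℝ) + 1 := by positivity
  have hexp : ((j : ℝ) + 1) * B + 1 - (k : ℝ) / l * (((j - 1 : ℕ) : ℝ) * ((j : ℝ) + 1)) < 0 := by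
    rw [Nat.cast_sub (show 1 ≤ j by omega), Nat.cast_one, hjR]
    have hk0 : (0 : ℝ) ≤ k := Nat.cast_nonneg k
    have hmain : (((l : ℝ) - 1) / 2 + 1) * (((k : ℝ) * ((l : ℝ) - 3) - 4) / (2 * l)) + 1 -
        (k : ℝ) / l * ((((l : ℝ) - 1) / 2 - 1) * (((l : ℝ) - 1) / 2 + 1)) = -1 / l := by
      field_simp; ring
    have hneg : (-1 : ℝ) / l < 0 := div_neg_of_neg_of_pos (by norm_num) hlpos
    have hjpos : (0 : ℝ) < ((l : ℝ) - 1) / 2 + 1 := by rw [← hjR]; exact hj1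
    nlinarith [mul_le_mul_of_nonneg_left hB' hjpos.le]
  -- conclude: `7^A · τ^n ≤ 7^A · (7^{-k/l})^n = 7^{A - (k/l)·n} < 7^0 = 1`
  have hB0 : (0 : ℝ) ≤ (7 : ℝ) ^ (-((k : ℝ) / l)) := (Real.rpow_pos_of_pos h70 _).le
  have hpow : τ ^ ((j - 1) * (j + 1)) ≤ ((7 : ℝ) ^ (-((k : ℝ) / l))) ^ ((j - 1) * (j + 1)) :=
    pow_le_pow_left₀ hτ0 hτ _
  have hA0 : (0 : ℝ) < (7 : ℝ) ^ (((j : ℝ) + 1) * B + 1) := Real.rpow_pos_of_pos h70 _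
  calc (7 : ℝ) ^ (((j : ℝ) + 1) * B + 1) * τ ^ ((j - 1) * (j + 1))
      ≤ (7 : ℝ) ^ (((j : ℝ) + 1) * B + 1) * ((7 : ℝ) ^ (-((k : ℝ) / l))) ^ ((j - 1) * (j + 1)) :=
        mul_le_mul_of_nonneg_left hpow hA0.le
    _ = (7 : ℝ) ^ (((j : ℝ) + 1) * B + 1 - (k : ℝ) / l * (((j - 1 : ℕ) : ℝ) * ((j : ℝ) + 1))) := by
        rw [← Real.rpow_natCast, ← Real.rpow_mul h70.le, ← Real.rpow_add h70]
        congr 1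
        push_cast
        ring
    _ < (7 : ℝ) ^ (0 : ℝ) := Real.rpow_lt_rpow_of_exponent_lt h7 hexp
    _ = 1 := Real.rpow_zero 7

/-! ## §2. Every datum over `(λ_k, l)` above the floor carries a deep top-label packet over `7` -/

/-- **Explicit depth floor for the `λ_k` family.** For `k ≥ 1`, `l` prime `≥ 11` with the integer criterion
`7^{4l+4}·(46080·l(l−1)²(l+1))^{2l} ≤ 7^{k(l−3)}`, EVERY genuine Θ-volume datum `T` at `(ratPoint λ_k, l)` has, at the top label
`i = (l−1)/2 − 1` and some fibre point `x₀ | 7` in the bad set, the explicit depth inequality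
`7^{((i+2)(d+a+b)+1)}·‖t_q(x₀)‖^{(i+1)²−1} < 1` at the CHOSEN realising q-idele (`GenuineK.exists_place_lamSeven` + §1; tame route,
no degree bound of `T.K`). [cite: Mochizuki2012, IUTchIV Prop. 1.2 p. 10, Cor. 2.2 (ii) proof (P5) p. 46] [claim: Mochizuki2012, status: disputed] -/
theorem exists_deep_place_lamSeven_of_criterion {k l : ℕ} (hk : 1 ≤ k) (hl : l.Prime) (h11 : 11 ≤ l)
    (hcrit : 7 ^ (4 * l + 4) * (46080 * (l * (l - 1) ^ 2 * (l + 1))) ^ (2 * l) ≤ 7 ^ (k * (l - 3)))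
    (T : Cor22.ThetaVolumeDatumAt (ratPoint ((2 : ℚ)⁻¹ + 2 / 7 ^ k)) l) :
    letI := T.instFieldF; letI := T.instNumberFieldF; letI := T.instAlgebraF; letI := T.instFieldK
    letI := T.instNumberFieldK; letI := T.instAlgebraK; letI := T.instFieldFbar; letI := T.instAlgebraFbar
    letI := T.instAlgebraKFbar; letI := T.instIsElliptic
    haveI : Fact (Nat.Prime 7) := ⟨by norm_num⟩
    ∃ (i : Fin (thetaIndex (pilotDataOfK T.D T.K)).lstar) (x₀ : (thetaIndex (pilotDataOfK T.D T.K)).Fibre (.inr ⟨7, by norm_num⟩)),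
      (i : ℕ) = (l - 1) / 2 - 1 ∧
      placeOf (pilotDataOfK T.D T.K) 7 x₀ ∈ (pilotDataOfK T.D T.K).S ∧
      (7 : ℝ) ^ ((((i : ℕ) : ℝ) + 2) * (differentOrd 7 (kOf (pilotDataOfK T.D T.K) 7 x₀)
          + logRadiusA 7 (absRamificationIdx 7 (kOf (pilotDataOfK T.D T.K) 7 x₀))
          + logRadiusB 7 (absRamificationIdx 7 (kOf (pilotDataOfK T.D T.K) 7 x₀))) + 1) *
        ‖(exists_realising_qIdeles_pilotDataOfK T.D).choose ⟨7, by norm_num⟩ x₀‖ ^ (((i : ℕ) + 1) ^ 2 - 1) < 1 := by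
  classical
  letI := T.instFieldF; letI := T.instNumberFieldF; letI := T.instAlgebraF; letI := T.instFieldK
  letI := T.instNumberFieldK; letI := T.instAlgebraK; letI := T.instFieldFbar; letI := T.instAlgebraFbar
  letI := T.instAlgebraKFbar; letI := T.instIsElliptic
  haveI : Fact (Nat.Prime 7) := ⟨by norm_num⟩
  obtain ⟨x₀, hS, -, -, hB, hnorm⟩ := GenuineK.exists_place_lamSeven hk hl h11 T
  have hlstar : (thetaIndex (pilotDataOfK T.D T.K)).lstar = (l - 1) / 2 := rfl
  have hil : (l - 1) / 2 - 1 < (thetaIndex (pilotDataOfK T.D T.K)).lstar := by rw [hlstar]; omega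
  refine ⟨⟨(l - 1) / 2 - 1, hil⟩, x₀, rfl, hS, ?_⟩
  have hN1 : 1 ≤ 46080 * (l * (l - 1) ^ 2 * (l + 1)) := by
    have : 1 ≤ l * (l - 1) ^ 2 * (l + 1) :=
      Nat.one_le_iff_ne_zero.mpr (Nat.mul_ne_zero (Nat.mul_ne_zero (by omega) (pow_ne_zero _ (by omega))) (by omega))
    omega
  have hodd : l % 2 = 1 := by
    rcases hl.eq_two_or_odd with h | h
    · omega
    · exact h
  have hidx : ((l - 1) / 2 - 1) + 1 = (l - 1) / 2 := by omega
  show (7 : ℝ) ^ _ * ‖(exists_realising_qIdeles_pilotDataOfK T.D).choose ⟨7, by norm_num⟩ x₀‖ ^ ((((l - 1) / 2 - 1) + 1) ^ 2 - 1) < 1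
  rw [hnorm, hidx]
  exact rpow_mul_pow_lt_one_of_criterion k l _ _ _ h11 hodd hN1 hB hcrit (by positivity) le_rfl

/-! ## §3. Per datum: the hull-level clause S_H fails above the floor (every choice of the free binders) -/

/-- **S_H FAILS at every datum over `(λ_k, l)` above the explicit floor.**  For `k ≥ 1`, `l` prime `≥ 11` with the integer
criterion of §2, at every genuine Θ-volume datum `T` over `(ratPoint λ_k, l)`, for EVERY region field, columns, frames, lattice,
Frobenioid signature, q-pilot data and Kummer datum `qK`: the hull-level clause `Cor312Vol.PilotKummerCompatHull` at the sharp genuine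
setting over `K` with the CHOSEN realising ideles and the PINNED reading (the per-datum instance shape of the `hSH`/`hSHw` binders of the
window certificates) is FALSE — abc-iut-C-cert-1's `GenuineK.not_pilotKummerCompatHull_chosen_of_explicit_depth` at the deep packet of §2.
Sharp reading; refuted-as-typed only; nothing about the number-level Corollary. [cite: Mochizuki2012, IUTchIII Cor. 3.12 Step (xi-f) p. 184]
[claim: Mochizuki2012, status: disputed] -/
theorem not_pilotKummerCompatHull_lamSeven_of_criterion {k l : ℕ} (hk : 1 ≤ k) (hl : l.Prime) (h11 : 11 ≤ l)
    (hcrit : 7 ^ (4 * l + 4) * (46080 * (l * (l - 1) ^ 2 * (l + 1))) ^ (2 * l) ≤ 7 ^ (k * (l - 3)))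
    (T : Cor22.ThetaVolumeDatumAt (ratPoint ((2 : ℚ)⁻¹ + 2 / 7 ^ k)) l) :
    letI := T.instFieldF; letI := T.instNumberFieldF; letI := T.instAlgebraF; letI := T.instFieldK
    letI := T.instNumberFieldK; letI := T.instAlgebraK; letI := T.instFieldFbar; letI := T.instAlgebraFbar
    letI := T.instAlgebraKFbar; letI := T.instIsElliptic
    ∀ (M : Type) [Field M] [NumberField M]
      (archPk : ∀ (j : (thetaIndex (pilotDataOfK T.D T.K)).Label) (vQ : (thetaIndex (pilotDataOfK T.D T.K)).VQ),
        Set ((logShellsDH (pilotDataOfK T.D T.K) (analyticLogv T.K)).Packet j vQ))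
      (archSub : ∀ (j : (thetaIndex (pilotDataOfK T.D T.K)).Label) (v : (thetaIndex (pilotDataOfK T.D T.K)).V),
        Set ((logShellsDH (pilotDataOfK T.D T.K) (analyticLogv T.K)).Packet j ((thetaIndex (pilotDataOfK T.D T.K)).over v)))
      (Ψ : ℤ → ∀ v : (thetaIndex (pilotDataOfK T.D T.K)).V, v ∈ (thetaIndex (pilotDataOfK T.D T.K)).Vbad →
        Set ((logShellsDH (pilotDataOfK T.D T.K) (analyticLogv T.K)).StarPacket v))
      (act : ℤ → ∀ v : (thetaIndex (pilotDataOfK T.D T.K)).V, v ∈ (thetaIndex (pilotDataOfK T.D T.K)).Vbad →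
        (logShellsDH (pilotDataOfK T.D T.K) (analyticLogv T.K)).StarPacket v →
          Module.End ℚ ((logShellsDH (pilotDataOfK T.D T.K) (analyticLogv T.K)).StarPacket v))
      (Mmod : ℤ → ∀ j : (thetaIndex (pilotDataOfK T.D T.K)).LabelStar,
        Set ((logShellsDH (pilotDataOfK T.D T.K) (analyticLogv T.K)).GlobalPacket j.1))
      (region : ℤ → ∀ j : (thetaIndex (pilotDataOfK T.D T.K)).LabelStar, FinDivisor M →
        ∀ vQ : (thetaIndex (pilotDataOfK T.D T.K)).VQ, Set ((logShellsDH (pilotDataOfK T.D T.K) (analyticLogv T.K)).Packet j.1 vQ))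
      (frobAdm : ℤ → ℤ → ∀ (j : (thetaIndex (pilotDataOfK T.D T.K)).Label) (vQ : (thetaIndex (pilotDataOfK T.D T.K)).VQ),
        Set ((logShellsDH (pilotDataOfK T.D T.K) (analyticLogv T.K)).Packet j vQ) → Prop)
      (frobLogvol : ℤ → ℤ → ∀ (j : (thetaIndex (pilotDataOfK T.D T.K)).Label) (vQ : (thetaIndex (pilotDataOfK T.D T.K)).VQ),
        Set ((logShellsDH (pilotDataOfK T.D T.K) (analyticLogv T.K)).Packet j vQ) → ℝ)
      (frobΨ : ℤ → ℤ → ∀ v : (thetaIndex (pilotDataOfK T.D T.K)).V, v ∈ (thetaIndex (pilotDataOfK T.D T.K)).Vbad →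
        Set ((logShellsDH (pilotDataOfK T.D T.K) (analyticLogv T.K)).StarPacket v))
      (frobMmod : ℤ → ℤ → ∀ j : (thetaIndex (pilotDataOfK T.D T.K)).LabelStar,
        Set ((logShellsDH (pilotDataOfK T.D T.K) (analyticLogv T.K)).GlobalPacket j.1))
      (unitImage : ℤ → ℤ → ℕ → ∀ (j : (thetaIndex (pilotDataOfK T.D T.K)).Label) (vQ : (thetaIndex (pilotDataOfK T.D T.K)).VQ),
        Set ((logShellsDH (pilotDataOfK T.D T.K) (analyticLogv T.K)).Packet j vQ))
      (ballImage : ℤ → ℤ → ∀ (j : (thetaIndex (pilotDataOfK T.D T.K)).Label) (vQ : (thetaIndex (pilotDataOfK T.D T.K)).VQ),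
        Set ((logShellsDH (pilotDataOfK T.D T.K) (analyticLogv T.K)).Packet j vQ))
      (thetaDiv : ℤ → ℤ → LgpDivisor M (thetaIndex (pilotDataOfK T.D T.K)).lstar)
      (n : ℤ) {HT : Type} {LogLink : HT → HT → Type} {IsFull : ∀ {s t : HT}, LogLink s t → Prop}
      (lat : LGPGaussianLogThetaLattice LogLink IsFull)
      {Frd : Type} {IsoF : Frd → Frd → Type} {Ob : Frd → Type} {realify : Frd → Frd} {Strip : Type}
      {IsoS : Strip → Strip → Type} {Mv : ∀ v : (thetaIndex (pilotDataOfK T.D T.K)).V, v ∈ (thetaIndex (pilotDataOfK T.D T.K)).Vbad → Type}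
      [∀ v h, Monoid (Mv v h)]
      (sig : GlobalLGPFrobenioidSignature (thetaIndex (pilotDataOfK T.D T.K)).lstar (thetaIndex (pilotDataOfK T.D T.K)).V
        (· ∈ (thetaIndex (pilotDataOfK T.D T.K)).Vbad) Frd IsoF Ob realify Strip IsoS Mv)
      (split : SplittingMonoids Mv) {ObΔ : Type}
      {N : ∀ v : (thetaIndex (pilotDataOfK T.D T.K)).V, v ∈ (thetaIndex (pilotDataOfK T.D T.K)).Vbad → Type}
      [∀ v h, Monoid (N v h)] (qData : QPilotData ObΔ N)
      (qK : ∀ v : (thetaIndex (pilotDataOfK T.D T.K)).V, v ∈ (thetaIndex (pilotDataOfK T.D T.K)).Vbad →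
        Set ((logShellsDH (pilotDataOfK T.D T.K) (analyticLogv T.K)).StarPacket v)),
    ¬ Cor312Vol.PilotKummerCompatHull
        (LatticeSituation.ofShells (logShellsDH (pilotDataOfK T.D T.K) (analyticLogv T.K)) M archPk archSub
          (summandPiecesPr (pilotDataOfK T.D T.K) (logvAnalytic_analyticLogv (F := T.K))).Adm
          (summandPiecesPr (pilotDataOfK T.D T.K) (logvAnalytic_analyticLogv (F := T.K))).logvol Ψ act Mmod region frobAdm
          frobLogvol frobΨ frobMmod unitImage ballImage thetaDiv)
        (settingPrVolSharp (pilotDataOfK T.D T.K) (logvAnalytic_analyticLogv (F := T.K)) M archPk archSub Ψ act Mmod region n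
          lat sig split qData (exists_realising_qIdeles_pilotDataOfK T.D).choose (exists_realising_thetaIdeles_pilotDataOfK T.D).choose
          (exists_realising_qIdeles_pilotDataOfK T.D).choose_spec.1 (exists_realising_qIdeles_pilotDataOfK T.D).choose_spec.2.1)
        (fun _ => Cor312.Setting.qRegion
          (settingPrVolSharp (pilotDataOfK T.D T.K) (logvAnalytic_analyticLogv (F := T.K)) M archPk archSub Ψ act Mmod region n
            lat sig split qData (exists_realising_qIdeles_pilotDataOfK T.D).choose (exists_realising_thetaIdeles_pilotDataOfK T.D).choose
            (exists_realising_qIdeles_pilotDataOfK T.D).choose_spec.1 (exists_realising_qIdeles_pilotDataOfK T.D).choose_spec.2.1))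
        qK := by
  letI := T.instFieldF; letI := T.instNumberFieldF; letI := T.instAlgebraF; letI := T.instFieldK
  letI := T.instNumberFieldK; letI := T.instAlgebraK; letI := T.instFieldFbar; letI := T.instAlgebraFbar
  letI := T.instAlgebraKFbar; letI := T.instIsElliptic
  intro M _ _ archPk archSub Ψ act Mmod region frobAdm frobLogvol frobΨ frobMmod
    unitImage ballImage thetaDiv n HT LogLink IsFull lat Frd IsoF Ob realify Strip IsoS Mv _ sig split ObΔ N _ qData qK
  obtain ⟨i, x₀, -, -, hdeep⟩ := exists_deep_place_lamSeven_of_criterion hk hl h11 hcrit T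
  exact GenuineK.not_pilotKummerCompatHull_chosen_of_explicit_depth T.D M archPk archSub Ψ act Mmod region frobAdm frobLogvol
    frobΨ frobMmod unitImage ballImage thetaDiv n lat sig split qData qK ⟨7, by norm_num⟩ i x₀ hdeep

/-! ## §4. Monotonicity and the decided table -/

/-- The criterion is monotone in `k` (the right-hand side grows). [folklore] -/
theorem criterion_mono {k k' l N : ℕ} (h : 7 ^ (4 * l + 4) * N ^ (2 * l) ≤ 7 ^ (k * (l - 3))) (hk : k ≤ k') :
    7 ^ (4 * l + 4) * N ^ (2 * l) ≤ 7 ^ (k' * (l - 3)) :=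
  h.trans (Nat.pow_le_pow_right (by norm_num) (Nat.mul_le_mul_right _ hk))

set_option exponentiation.threshold 4096 in
/-- **The decided table** (kernel arithmetic on the integer powers, then monotonicity): the criterion of §2 holds for
`(l, k)` with `l = 11, k ≥ 35`; `l = 13, k ≥ 34`; `l ∈ {17, 19, 23, 29, 31, 37, 41, 43}, k ≥ 33` — the eight `l` of
WINDOW-TABLE-v1-HEX plus `41, 43`.  (Desk check: these are also the exact thresholds of the real inequality.) [folklore] -/
theorem criterion_of_table {k l : ℕ}
    (h : (l = 11 ∧ 35 ≤ k) ∨ (l = 13 ∧ 34 ≤ k) ∨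
      ((l = 17 ∨ l = 19 ∨ l = 23 ∨ l = 29 ∨ l = 31 ∨ l = 37 ∨ l = 41 ∨ l = 43) ∧ 33 ≤ k)) :
    7 ^ (4 * l + 4) * (46080 * (l * (l - 1) ^ 2 * (l + 1))) ^ (2 * l) ≤ 7 ^ (k * (l - 3)) := by
  rcases h with ⟨rfl, hk⟩ | ⟨rfl, hk⟩ | ⟨hl, hk⟩
  · exact criterion_mono (k := 35) (by norm_num) hk
  · exact criterion_mono (k := 34) (by norm_num) hk
  · rcases hl with rfl | rfl | rfl | rfl | rfl | rfl | rfl | rfl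
    · exact criterion_mono (k := 33) (by norm_num) hk
    · exact criterion_mono (k := 33) (by norm_num) hk
    · exact criterion_mono (k := 33) (by norm_num) hk
    · exact criterion_mono (k := 33) (by norm_num) hk
    · exact criterion_mono (k := 33) (by norm_num) hk
    · exact criterion_mono (k := 33) (by norm_num) hk
    · exact criterion_mono (k := 33) (by norm_num) hk
    · exact criterion_mono (k := 33) (by norm_num) hk

/-- Primality of the table's `l`. [folklore] -/
theorem prime_of_table {l : ℕ}
    (h : l = 11 ∨ l = 13 ∨ l = 17 ∨ l = 19 ∨ l = 23 ∨ l = 29 ∨ l = 31 ∨ l = 37 ∨ l = 41 ∨ l = 43) : l.Prime ∧ 11 ≤ l := by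
  rcases h with rfl | rfl | rfl | rfl | rfl | rfl | rfl | rfl | rfl | rfl <;> exact ⟨by norm_num, by norm_num⟩

/-- **Table form of §2**: at `l = 11` (`k ≥ 35`), `l = 13` (`k ≥ 34`), `l ∈ {17, 19, 23, 29, 31, 37, 41, 43}` (`k ≥ 33`), every
genuine Θ-volume datum over `(λ_k, l)` carries the deep top-label packet over `7`. [cite: Mochizuki2012, IUTchIV Prop. 1.2 p. 10]
[claim: Mochizuki2012, status: disputed] -/
theorem exists_deep_place_lamSeven_of_table {k l : ℕ}
    (h : (l = 11 ∧ 35 ≤ k) ∨ (l = 13 ∧ 34 ≤ k) ∨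
      ((l = 17 ∨ l = 19 ∨ l = 23 ∨ l = 29 ∨ l = 31 ∨ l = 37 ∨ l = 41 ∨ l = 43) ∧ 33 ≤ k))
    (T : Cor22.ThetaVolumeDatumAt (ratPoint ((2 : ℚ)⁻¹ + 2 / 7 ^ k)) l) :
    letI := T.instFieldF; letI := T.instNumberFieldF; letI := T.instAlgebraF; letI := T.instFieldK
    letI := T.instNumberFieldK; letI := T.instAlgebraK; letI := T.instFieldFbar; letI := T.instAlgebraFbar
    letI := T.instAlgebraKFbar; letI := T.instIsElliptic
    haveI : Fact (Nat.Prime 7) := ⟨by norm_num⟩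
    ∃ (i : Fin (thetaIndex (pilotDataOfK T.D T.K)).lstar) (x₀ : (thetaIndex (pilotDataOfK T.D T.K)).Fibre (.inr ⟨7, by norm_num⟩)),
      (i : ℕ) = (l - 1) / 2 - 1 ∧
      placeOf (pilotDataOfK T.D T.K) 7 x₀ ∈ (pilotDataOfK T.D T.K).S ∧
      (7 : ℝ) ^ ((((i : ℕ) : ℝ) + 2) * (differentOrd 7 (kOf (pilotDataOfK T.D T.K) 7 x₀)
          + logRadiusA 7 (absRamificationIdx 7 (kOf (pilotDataOfK T.D T.K) 7 x₀))
          + logRadiusB 7 (absRamificationIdx 7 (kOf (pilotDataOfK T.D T.K) 7 x₀))) + 1) *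
        ‖(exists_realising_qIdeles_pilotDataOfK T.D).choose ⟨7, by norm_num⟩ x₀‖ ^ (((i : ℕ) + 1) ^ 2 - 1) < 1 := by
  have hl : l = 11 ∨ l = 13 ∨ l = 17 ∨ l = 19 ∨ l = 23 ∨ l = 29 ∨ l = 31 ∨ l = 37 ∨ l = 41 ∨ l = 43 := by
    rcases h with ⟨h1, -⟩ | ⟨h1, -⟩ | ⟨h1, -⟩
    · exact Or.inl h1
    · exact Or.inr (Or.inl h1)
    · exact Or.inr (Or.inr h1)
  have hk : 1 ≤ k := by rcases h with ⟨-, h1⟩ | ⟨-, h1⟩ | ⟨-, h1⟩ <;> omega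
  obtain ⟨hp, h11⟩ := prime_of_table hl
  exact exists_deep_place_lamSeven_of_criterion hk hp h11 (criterion_of_table h) T

/-! ## §5. A uniform all-primes fallback -/

/-- **Uniform fallback.** For `l ≥ 11` with `l ≤ 7^m`, the elementary condition `(16 + 8m)·l + 4 ≤ k(l−3)` implies the criterion
(`N(l) ≤ 92160·l⁴ < 7^6·l⁴ ≤ 7^{6+4m}`). [folklore] -/
theorem criterion_of_le_pow {k l m : ℕ} (h11 : 11 ≤ l) (hlm : l ≤ 7 ^ m) (hk : (16 + 8 * m) * l + 4 ≤ k * (l - 3)) :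
    7 ^ (4 * l + 4) * (46080 * (l * (l - 1) ^ 2 * (l + 1))) ^ (2 * l) ≤ 7 ^ (k * (l - 3)) := by
  have hN : 46080 * (l * (l - 1) ^ 2 * (l + 1)) ≤ 7 ^ (6 + 4 * m) := by
    have h1 : (l - 1) ^ 2 ≤ l ^ 2 := Nat.pow_le_pow_left (by omega) 2
    have h2 : l + 1 ≤ 2 * l := by omega
    have h4 : l ^ 4 ≤ (7 ^ m) ^ 4 := Nat.pow_le_pow_left hlm 4
    calc 46080 * (l * (l - 1) ^ 2 * (l + 1)) ≤ 46080 * (l * l ^ 2 * (2 * l)) := by gcongr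
      _ = 92160 * l ^ 4 := by ring
      _ ≤ 7 ^ 6 * (7 ^ m) ^ 4 := by gcongr; norm_num
      _ = 7 ^ (6 + 4 * m) := by ring
  calc 7 ^ (4 * l + 4) * (46080 * (l * (l - 1) ^ 2 * (l + 1))) ^ (2 * l)
      ≤ 7 ^ (4 * l + 4) * (7 ^ (6 + 4 * m)) ^ (2 * l) := by gcongr
    _ = 7 ^ ((16 + 8 * m) * l + 4) := by rw [← pow_mul, ← pow_add]; ring_nf
    _ ≤ 7 ^ (k * (l - 3)) := Nat.pow_le_pow_right (by norm_num) hk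

end HexFloor

end Summit.ABC.IUTFork.Conditional

end
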